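import Summits.AnomalousDissipation.AnomalousDissipation.Theorems.ScalarAnomalySteadySourceFormal.Negative.HeatProfile

/-!
# Negative knowledge for the crux `ScalarAnomalySteadySourceFormal` (stmt-AnomalousDissipation-0448), III-b:
# LOAD-BEARING ANALYSIS

Certified copy of §4 of the cdisprove work file: `cruxWithoutVarianceBound_holds` (delete clause (v) ⇒
the crux is TRUE by the heat equation, dissipation `(j+1)/(8π²)`), `varianceUnbounded_heatFamily`,
`cruxIndexedSource_holds` (a `j`-dependent source ⇒ TRUE with variance `1/(32π⁴)`, anomaly `1/(8π²)`:
scalar twin of `Cheskidov2023_thm13_not_forceRobustNoAnomaly` — a refutation must use that `h` is ONE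
`ν`-independent function), `cruxWithoutFloor_holds` (non-vacuity of the hypothesis bundle),
`heatFamily_not_anomalous` (steady-heat sub-family dead).  Supports stmt-AnomalousDissipation-0448.
-/

set_option linter.dupNamespace false

noncomputable section

open scoped BigOperators Topology ENNReal NNReal InnerProductSpace ContDiff
open Filter Set Function MeasureTheory UnitAddTorus Complex

namespace Summit.AnomalousDissipation.AnomalousDissipation.Theorems.ScalarAnomalySteadySourceFormal.Negative

open Literature.Analysis
open Literature.Analysis.FunctionSpaces Literature.Analysis.FunctionSpaces.Torus
open Literature.Analysis.FluidPDE Literature.Analysis.FluidPDE.Torus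
open Summit.AnomalousDissipation.AnomalousDissipation.Theses.TwoAndHalfD

/-! ### Load-bearing analysis -/

section LoadBearing

/-- The viscosity ladder `ν_j = 1/(j+1)`. [folklore] -/
def nuSeq (j : ℕ) : ℝ := 1 / ((j : ℝ) + 1)

/-- Helper `nuSeq_pos` (see the section docstring). [folklore] -/
theorem nuSeq_pos (j : ℕ) : 0 < nuSeq j := by
  unfold nuSeq; positivity

/-- Helper `nuSeq_le_one` (see the section docstring). [folklore] -/
theorem nuSeq_le_one (j : ℕ) : nuSeq j ≤ 1 := by
  unfold nuSeq
  rw [div_le_one (by positivity)]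
  linarith [(Nat.cast_nonneg j : (0 : ℝ) ≤ j)]

/-- Helper `tendsto_nuSeq` (see the section docstring). [folklore] -/
theorem tendsto_nuSeq : Tendsto nuSeq atTop (nhds 0) :=
  tendsto_one_div_add_atTop_nhds_zero_nat

/-- The first axial frequency `e₀ = (1, 0)`. [folklore] -/
abbrev k₁ : Fin 2 → ℤ := axialFreq 1

/-- Helper `k₁_ne_zero` (see the section docstring). [folklore] -/
theorem k₁_ne_zero : k₁ ≠ 0 := axialFreq_ne_zero one_ne_zero

/-- Helper `lam_k₁` (see the section docstring). [folklore] -/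
theorem lam_k₁ : lam k₁ = 4 * Real.pi ^ 2 := by
  rw [lam_axialFreq]; push_cast; ring

/-- Helper `lam_k₁_pos` (see the section docstring). [folklore] -/
theorem lam_k₁_pos : 0 < lam k₁ := lam_pos_axialFreq one_ne_zero

/-- **LOAD-BEARING (v): without the variance bound the crux is TRUE, by the heat equation.**
Witness: `g = 0`, flow at rest, `h = cos(2πx₁)`, `ν_j = 1/(j+1)`, `θ_j ≡ θ₀_j = h/(4π²ν_j)`:
honest mean dissipation `(j+1)/(8π²) ≥ 1/(8π²)`.  Hence ANY refutation of the crux must use the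
scalar-variance bound quantitatively — dissipation of order `1/ν` is available without it — and
the bound is violated by this family exactly at the rate `⟨‖θ_j‖²⟩ = (j+1)²/(32π⁴)`
(`varianceUnbounded_heatFamily`). [folklore] -/
theorem cruxWithoutVarianceBound_holds :
    ∃ (g : (UnitAddTorus (Fin 2)) → (EuclideanSpace ℝ (Fin 2))) (h : (UnitAddTorus (Fin 2)) → ℝ), IsAdmissible g h ∧
    ∃ (ν : ℕ → ℝ) (v₀ : ℕ → (UnitAddTorus (Fin 2)) → (EuclideanSpace ℝ (Fin 2)))
      (v : ℕ → ℝ → (UnitAddTorus (Fin 2)) → (EuclideanSpace ℝ (Fin 2))) (θ₀ : ℕ → (UnitAddTorus (Fin 2)) → ℝ)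
      (θ : ℕ → ℝ → (UnitAddTorus (Fin 2)) → ℝ), IsCandidate g h ν v₀ v θ₀ θ ∧ EnergyBounded v ∧ Anomalous ν θ := by
  refine ⟨fun _ => 0, cosMode k₁ 1, isAdmissible_zero_cosMode k₁_ne_zero 1, nuSeq, fun _ _ => 0,
    fun _ _ _ => 0, fun j => heatProfile k₁ 1 (nuSeq j), fun j _ => heatProfile k₁ 1 (nuSeq j),
    ⟨nuSeq_pos, tendsto_nuSeq, fun j => isGlobalLerayHopf_rest (nuSeq j),
      fun j => memLp_heatProfile k₁ 1 (nuSeq j),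
      fun j => heatProfile_isWeak lam_k₁_pos.ne' (nuSeq_pos j).ne' 1⟩,
    ⟨0, fun j => meanEnergy_rest.le⟩,
    ⟨1 / (2 * lam k₁), by have := lam_k₁_pos; positivity, fun j => ?_⟩⟩
  rw [longTimeAvgSup_dissipation_heatProfile k₁_ne_zero lam_k₁_pos.ne' (nuSeq_pos j).ne', one_pow]
  apply one_div_le_one_div_of_le
  · exact mul_pos two_pos (mul_pos (nuSeq_pos j) lam_k₁_pos)
  · have h1 := nuSeq_le_one j
    have h2 := lam_k₁_pos
    nlinarith

/-- The same heat family violates clause (v) honestly: its mean variances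
`⟨‖θ_j‖²⟩ = ((j+1)/(4π²))²/2` are unbounded in `j` (so it is NOT a witness of the crux — the
variance clause alone rules it out). [folklore] -/
theorem varianceUnbounded_heatFamily :
    ¬ VarianceBounded (fun j (_ : ℝ) => heatProfile k₁ 1 (nuSeq j)) := by
  rintro ⟨E, hE⟩
  have hval : ∀ j : ℕ, longTimeAvgSup (fun _ : ℝ => scalarL2Sq (heatProfile k₁ 1 (nuSeq j))) =
      (((j : ℝ) + 1) / lam k₁) ^ 2 / 2 := fun j => by
    rw [longTimeAvgSup_scalarL2Sq_heatProfile k₁_ne_zero, nuSeq]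
    congr 2
    field_simp
  -- pick `j` with `((j+1)/λ)²/2 > E`
  obtain ⟨j, hj⟩ := exists_nat_gt (2 * |E| * lam k₁ ^ 2 + lam k₁ ^ 2)
  have h := hE j
  rw [hval j] at h
  have hl := lam_k₁_pos
  have hj1 : (1 : ℝ) ≤ (j : ℝ) + 1 := by linarith [(Nat.cast_nonneg j : (0 : ℝ) ≤ j)]
  have hE' : E ≤ |E| := le_abs_self E
  have hval' : (((j : ℝ) + 1) / lam k₁) ^ 2 / 2 = ((j : ℝ) + 1) ^ 2 / (2 * lam k₁ ^ 2) := by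
    field_simp
  have hsq : (j : ℝ) + 1 ≤ ((j : ℝ) + 1) ^ 2 := by nlinarith
  have step1 : ((j : ℝ) + 1) / (2 * lam k₁ ^ 2) ≤ ((j : ℝ) + 1) ^ 2 / (2 * lam k₁ ^ 2) :=
    div_le_div_of_nonneg_right hsq (by positivity)
  have step2 : (2 * |E| * lam k₁ ^ 2 + lam k₁ ^ 2) / (2 * lam k₁ ^ 2) < ((j : ℝ) + 1) / (2 * lam k₁ ^ 2) :=
    div_lt_div_of_pos_right (by linarith) (by positivity)
  have step3 : (2 * |E| * lam k₁ ^ 2 + lam k₁ ^ 2) / (2 * lam k₁ ^ 2) = |E| + 1 / 2 := by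
    field_simp
  rw [hval'] at h
  linarith

/-- The frequency ladder `k_j = (j+1, 0)` with `λ_{k_j} = 4π²(j+1)²`. [folklore] -/
def kSeq (j : ℕ) : Fin 2 → ℤ := axialFreq ((j : ℤ) + 1)

/-- Helper `kSeq_ne_zero` (see the section docstring). [folklore] -/
theorem kSeq_ne_zero (j : ℕ) : kSeq j ≠ 0 :=
  axialFreq_ne_zero (by exact_mod_cast Nat.succ_ne_zero j)

/-- Helper `lam_kSeq` (see the section docstring). [folklore] -/
theorem lam_kSeq (j : ℕ) : lam (kSeq j) = 4 * Real.pi ^ 2 * ((j : ℝ) + 1) ^ 2 := by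
  rw [kSeq, lam_axialFreq]; push_cast; ring

/-- Helper `lam_kSeq_pos` (see the section docstring). [folklore] -/
theorem lam_kSeq_pos (j : ℕ) : 0 < lam (kSeq j) := by rw [lam_kSeq]; positivity

/-- The viscosity ladder `ν_j = 1/(j+1)²`, tuned so that `ν_j λ_{k_j} = 4π²`. [folklore] -/
def nuSeq₂ (j : ℕ) : ℝ := (1 / ((j : ℝ) + 1)) ^ 2

/-- Helper `nuSeq₂_pos` (see the section docstring). [folklore] -/
theorem nuSeq₂_pos (j : ℕ) : 0 < nuSeq₂ j := by unfold nuSeq₂; positivity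

/-- Helper `tendsto_nuSeq₂` (see the section docstring). [folklore] -/
theorem tendsto_nuSeq₂ : Tendsto nuSeq₂ atTop (nhds 0) := by
  have h := (tendsto_one_div_add_atTop_nhds_zero_nat (𝕜 := ℝ)).pow 2
  rw [zero_pow two_ne_zero] at h
  exact h

/-- Helper `nuSeq₂_mul_lam` (see the section docstring). [folklore] -/
theorem nuSeq₂_mul_lam (j : ℕ) : nuSeq₂ j * lam (kSeq j) = 4 * Real.pi ^ 2 := by
  rw [nuSeq₂, lam_kSeq]
  field_simp

/-- **LOAD-BEARING (ν-independence of the source): with a `j`-dependent source the crux is TRUE,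
by the heat equation at the diffusive scale.**  Witness: flow at rest,
`h_j = cos(2π(j+1)x₁)`, `ν_j = (j+1)⁻²` (so `ν_j λ_{k_j} = 4π²`), `θ_j ≡ h_j/(4π²)`: honest means
`⟨‖θ_j‖²⟩ = 1/(32π⁴)` (bounded) and `⟨ν_j‖∇θ_j‖²⟩ = 1/(8π²)` (anomalous).  Hence ANY refutation
must use that `h` is ONE fixed function (its spectrum cannot follow the diffusive scale
`|k| ~ ν^{-1/2}`) — the scalar twin of the catalogued
`Cheskidov2023_thm13_not_forceRobustNoAnomaly` (ν-dependent forces DO produce anomalies), and the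
reason no "force-robust" energy estimate can kill the crux. [folklore] -/
theorem cruxIndexedSource_holds :
    ∃ (g : (UnitAddTorus (Fin 2)) → (EuclideanSpace ℝ (Fin 2))) (h : ℕ → (UnitAddTorus (Fin 2)) → ℝ), (∀ j, IsAdmissible g (h j)) ∧
    ∃ (ν : ℕ → ℝ) (v₀ : ℕ → (UnitAddTorus (Fin 2)) → (EuclideanSpace ℝ (Fin 2)))
      (v : ℕ → ℝ → (UnitAddTorus (Fin 2)) → (EuclideanSpace ℝ (Fin 2))) (θ₀ : ℕ → (UnitAddTorus (Fin 2)) → ℝ)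
      (θ : ℕ → ℝ → (UnitAddTorus (Fin 2)) → ℝ), (∀ j, 0 < ν j) ∧ Tendsto ν atTop (nhds 0) ∧
        (∀ j, IsGlobalLerayHopf (ν j) (fun _ => g) (v₀ j) (v j)) ∧ (∀ j, MemLp (θ₀ j) 2 volume) ∧
        (∀ j, IsWeakScalarTransportForced (ν j) (v j) (fun _ => h j) (θ₀ j) (θ j)) ∧
        EnergyBounded v ∧ VarianceBounded θ ∧ Anomalous ν θ := by
  refine ⟨fun _ => 0, fun j => cosMode (kSeq j) 1, fun j => isAdmissible_zero_cosMode (kSeq_ne_zero j) 1,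
    nuSeq₂, fun _ _ => 0, fun _ _ _ => 0, fun j => heatProfile (kSeq j) 1 (nuSeq₂ j),
    fun j _ => heatProfile (kSeq j) 1 (nuSeq₂ j), nuSeq₂_pos, tendsto_nuSeq₂,
    fun j => isGlobalLerayHopf_rest (nuSeq₂ j), fun j => memLp_heatProfile _ 1 _,
    fun j => heatProfile_isWeak (lam_kSeq_pos j).ne' (nuSeq₂_pos j).ne' 1,
    ⟨0, fun j => meanEnergy_rest.le⟩, ⟨(1 / (4 * Real.pi ^ 2)) ^ 2 / 2, fun j => ?_⟩,
    ⟨1 / (2 * (4 * Real.pi ^ 2)), by positivity, fun j => ?_⟩⟩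
  · rw [longTimeAvgSup_scalarL2Sq_heatProfile (kSeq_ne_zero j), nuSeq₂_mul_lam]
  · rw [longTimeAvgSup_dissipation_heatProfile (kSeq_ne_zero j) (lam_kSeq_pos j).ne' (nuSeq₂_pos j).ne',
      nuSeq₂_mul_lam, one_pow]

/-- **NON-VACUITY of the hypothesis bundle**: the solution clauses together with BOTH `limsup`
bounds have an honest (non-junk) model — flow at rest, zero source, zero scalar (written as the
amplitude-`0` heat profile so that §3 applies verbatim).  Only the floor `ε > 0` separates this
model from a witness: clause (vi) is load-bearing for any proof, as (v) is for any refutation. [folklore] -/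
theorem cruxWithoutFloor_holds :
    ∃ (g : (UnitAddTorus (Fin 2)) → (EuclideanSpace ℝ (Fin 2))) (h : (UnitAddTorus (Fin 2)) → ℝ), IsAdmissible g h ∧
    ∃ (ν : ℕ → ℝ) (v₀ : ℕ → (UnitAddTorus (Fin 2)) → (EuclideanSpace ℝ (Fin 2)))
      (v : ℕ → ℝ → (UnitAddTorus (Fin 2)) → (EuclideanSpace ℝ (Fin 2))) (θ₀ : ℕ → (UnitAddTorus (Fin 2)) → ℝ)
      (θ : ℕ → ℝ → (UnitAddTorus (Fin 2)) → ℝ), IsCandidate g h ν v₀ v θ₀ θ ∧ EnergyBounded v ∧ VarianceBounded θ := by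
  refine ⟨fun _ => 0, cosMode k₁ 0, isAdmissible_zero_cosMode k₁_ne_zero 0, nuSeq, fun _ _ => 0,
    fun _ _ _ => 0, fun j => heatProfile k₁ 0 (nuSeq j), fun j _ => heatProfile k₁ 0 (nuSeq j),
    ⟨nuSeq_pos, tendsto_nuSeq, fun j => isGlobalLerayHopf_rest (nuSeq j),
      fun j => memLp_heatProfile k₁ 0 (nuSeq j),
      fun j => heatProfile_isWeak lam_k₁_pos.ne' (nuSeq_pos j).ne' 0⟩,
    ⟨0, fun j => meanEnergy_rest.le⟩, ⟨0, fun j => ?_⟩⟩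
  rw [longTimeAvgSup_scalarL2Sq_heatProfile k₁_ne_zero]
  simp

/-- For the record, the zero-amplitude family has identically vanishing dissipation means: the
three clauses (iv), (v), (vi) cannot be met by the heat equation with a FIXED source at ANY
amplitude — large amplitude/ small `ν` breaks (v) (`varianceUnbounded_heatFamily`), and the
dissipation mean `a²/(2νλ)` is monotone in the same parameter `a²/ν` as the variance
`a²/(2ν²λ²)·…`: along any heat family, `⟨ν‖∇θ‖²⟩ = νλ · ⟨‖θ‖²⟩·… ≤ λ ν_j · E → 0`
(`dissipation_le_of_variance_heat`). [folklore] -/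
theorem dissipation_eq_mul_variance_heat {k : Fin 2 → ℤ} (hk : k ≠ 0) (hlam : lam k ≠ 0) {ν : ℝ}
    (hν : ν ≠ 0) (a : ℝ) :
    longTimeAvgSup (dissipation ν (fun _ => heatProfile k a ν)) =
      ν * lam k * longTimeAvgSup (fun _ : ℝ => scalarL2Sq (heatProfile k a ν)) := by
  rw [longTimeAvgSup_dissipation_heatProfile hk hlam hν, longTimeAvgSup_scalarL2Sq_heatProfile hk]
  field_simp

/-- **The steady heat sub-family is dead**: if a family of steady heat profiles (fixed mode `k`,
amplitudes `a_j`, viscosities `ν_j → 0`) has mean variance `≤ E`, its mean dissipation is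
`≤ λ_k ν_j E → 0`; in particular it dips below every `ε > 0`. [folklore] -/
theorem heatFamily_not_anomalous {k : Fin 2 → ℤ} (hk : k ≠ 0) (hlam : 0 < lam k) {ν : ℕ → ℝ}
    (hν : ∀ j, 0 < ν j) (hν0 : Tendsto ν atTop (nhds 0)) (a : ℕ → ℝ) {E : ℝ}
    (hE : ∀ j, longTimeAvgSup (fun _ : ℝ => scalarL2Sq (heatProfile k (a j) (ν j))) ≤ E) :
    ¬ Anomalous ν (fun j _ => heatProfile k (a j) (ν j)) := by
  rintro ⟨ε, hε, hfloor⟩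
  have hE0 : 0 ≤ E := (hE 0).trans' (by
    rw [longTimeAvgSup_scalarL2Sq_heatProfile hk]; positivity)
  -- eventually `ν_j λ E < ε`
  have hev : ∀ᶠ j in atTop, ν j < ε / (lam k * (E + 1)) :=
    (tendsto_order.1 hν0).2 _ (by positivity)
  obtain ⟨j, hj⟩ := hev.exists
  have h1 := hfloor j
  rw [dissipation_eq_mul_variance_heat hk hlam.ne' (hν j).ne'] at h1
  have h2 : ν j * lam k * longTimeAvgSup (fun _ : ℝ => scalarL2Sq (heatProfile k (a j) (ν j))) ≤
      ν j * lam k * E := mul_le_mul_of_nonneg_left (hE j) (mul_nonneg (hν j).le hlam.le)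
  have h3 : ν j * lam k * E < ε := by
    have := hj
    rw [lt_div_iff₀ (by positivity)] at this
    nlinarith [(hν j).le, hlam.le]
  linarith

end LoadBearing

end Summit.AnomalousDissipation.AnomalousDissipation.Theorems.ScalarAnomalySteadySourceFormal.Negative
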